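import Mathlib
import Summits.QuantumFields.YangMills.Theses.CoarseStiffnessTail
import Literature.MathematicalPhysics.QuantumFieldTheory.Balaban1983to89.T3ThresholdRemoval

/-!
# Route `CoarseStiffnessTail` — the crux `CappedCoarseStiffnessL` (stmt-QuantumFields-25301) IS A STATEMENT ABOUT BAŁABAN'S UNIT LAWS:
# `CappedCoarseStiffnessL ⇔ TopSlice (j = K only) ⇔ UnitLawSlice` (lead's certificate, seat `ym-line-cst-p1` g4; helper on 25301)

KERNEL-CHECKED EQUIVALENCES (constants `(c₀, C₀, γ₁)` kept in every direction).  Write `β_h = (γL^{-h})⁻¹`, `θ_γ(h) = θBal L γ b₀ p₀ h`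
(`= g_h·p(g_h)`, `g_h² = γL^{-h}`), `Ū^{j}` = the `j`-fold (0.4)-block-averaged field of run `K`.  The crux quantifies over ALL families `F`
(`F.L = L`, volume exponent `m ≥ 1`), couplings `0 < γ ≤ γ₁`, cut-offs `K` AND heights `j ≤ K`:
`∫ exp(c₀·β_{K−j}·Σ_{a ∈ Plaq_j} min(|Ū^{j}(∂a) − 1|², θ_γ(K−j)²)) dGibbs_K ≤ e^{C₀·#Plaq_j}`.

THE OBSERVATION.  Run `K = j + d` of `F` at coupling `γ` IS run `j` of the refined family `F.refine d` (volume exponent `m + d`) at coupling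
`γL^{-d}`: same finest lattice (`2L^{m+K}` sites per direction), same Wilson weight `β_K` (`T3Family.refine_β`), Bałaban's block averagings (0.4)
matched level by level (`T3LevelShift.iter_fieldShift`) — and under this identification level `j` of the first tower is the TOP level (the unit
lattice) of the second, the tilt's coupling is `β_{K−j}(γ) = β_0(γL^{-d}) = (γL^{-d})⁻¹` and its window is `θ_γ(d) = θ_{γL^{-d}}(0)`
(`θBal_eq_θBal_refine_zero`).  Hence (§2, `cappedCoarseStiffnessL_iff_topSlice`)

  `CappedCoarseStiffnessL ⇔ TopSlice`,  TopSlice := the crux at `j = K` only: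
  `∀ F γ K: ∫ exp(c₀·γ⁻¹·Σ_{a ∈ Plaq_K} min(|Ū^{K}(∂a) − 1|², θ_γ(0)²)) dGibbs_K ≤ e^{C₀·#Plaq_K}`

(`⇒`: specialise `j := K`; `⇐`: given `(K, j)` apply the slice to the admissible pair `(F.refine (K−j), γL^{-(K−j)})` — `γL^{-(K−j)} ≤ γ ≤ γ₁`,
`(F.refine _).L = L` — and transport, `integral_capTilt_eq_refine`, `card_plaq_eq_refine`), and, pushing forward under the unit transport
`unitA = unitShift ∘ avg^K` (`T3ThresholdRemoval.integral_unitLaw`; §2 `topSlice_iff_unitLawSlice`, `cappedCoarseStiffnessL_iff_unitLawSlice`)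

  `CappedCoarseStiffnessL ⇔ UnitLawSlice`,  UnitLawSlice :=
  `∀ F γ K: ∫ exp(c₀·γ⁻¹·Σ_{p ∈ Plaq(T₁)} min(|V(∂p) − 1|², θ_γ(0)²)) d(unitLaw F ℰp γ K)(V) ≤ e^{C₀·#Plaq(T₁)}`,

`T₁` = the unit torus of the family (`2L^m` sites per direction; its plaquette count does not depend on `K`), `unitLaw` = Bałaban's unit law (the
push-forward of `Gibbs_K` under `unitA`; in his representation `ρ_K(V)dV`, `ρ_K` the FINAL density of [Balaban1985UV3] (2) p.256).

READING (for planners / a siege / the instrument; nothing below is a new claim about Bałaban's estimates).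
(1) The crux's clause «uniformly in the height `j ≤ K`» is REDUNDANT: it follows from uniformity in the coupling `γ → 0` (which encodes the
    height `h = K − j` as the unit coupling `γL^{-h}`) and in the volume exponent `m` (which encodes the level-`j` lattice as the unit torus of
    exponent `m + h`).  What the crux asks is exactly: the law of the `K`-fold averaged unit field — the parent route `UnitScaleTilt`'s own object
    (its K1/K2 are statements about these unit laws) — has free energy `O(1)` per unit plaquette under the capped quadratic tilt AT ITS OWN COUPLING,
    uniformly in `K` (ultraviolet stability), in `γ ≤ γ₁` (deep weak coupling) and in `m` (unit volume), jointly.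
(2) Consequently the line card's chain for the open stub (`Cruxes/CappedCoarseStiffnessL/Lines/birth.md` §Hardest stub, items 1–4: (5) p.256 at
    two couplings, (70)–(71) p.273, the small/large-field split) is only ever needed for the FINAL density of a run, never for intermediate
    effective densities — at the price of all smaller couplings `γL^{-h}` and all larger unit volumes.
(3) `γ`-uniformity is the essence, not an artefact (cf. the g2 memo: the bare `j = 0` rung is not elementary uniformly in `γ`): §3 records the
    BARE unit-torus statement (pure Wilson law at `β = γ⁻¹` on `(2L^m)³`, no averaging: the cut-off `K = 0` instance) as a kernel COROLLARY of the
    crux (`bareSlice_of_cappedCoarseStiffnessL`); by `integral_capTilt_eq_refine` the crux's whole `j = 0` sub-family is that statement read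
    over all `(m, γ)`.  A refutation of the bare statement refutes the crux.
(4) Instrument dictionary (JOB A of `ym-r3-instr-1` measured the tilted free energy per level-`j` plaquette `f(j, K)` at fixed `γ, m`): by
    `integral_capTilt_eq_refine`, `f(K, j; γ, m) = f_top(j; γL^{-(K−j)}, m + K − j)`; JOB A's «fixed `h = K − j`, `K` growing» series is ultraviolet
    stability of the top-slice free energy at FIXED unit coupling `γL^{-h}` and volume exponent `m + h` (run length `j = K − h` growing); its
    «fixed `j`, `K` growing» series is the `γL^{-(K−j)} → 0` limit at growing volume.

HONEST SCOPE.  Transport/bookkeeping on top of the tree's landed level-identification kit (`T3LevelShift`, `T3ThresholdRemoval`; the same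
refinement transport as `LargeFieldMassRefinementTailOfHeightTail` / `RenyiTelescopePlaquetteTransport`); NO estimate of any Gibbs integral is proved; the crux, its top slice and its unit-law
slice are all OPEN (XL: [Balaban1985UV3] (5) p.256 at two couplings + (70)–(71) p.273 INTEGRATED against the Gibbs law — unprinted as integrated
bounds); no rung, leaf or summit is proved: `YM3TorusSU2` (rung R3, a RECORD rung, not the Clay statement) is NOT proved; the Yang–Mills mass
gap is NOT touched.

References: T. Bałaban, CMP **102** (1985) 255–275 [Balaban1985UV3] ((1)–(3) p.256: the scaled family and its Gibbs laws; (2) p.256: the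
densities `ρ_k`; (5) p.256, (7) p.257); T. Bałaban, CMP **109** (1987) 249–301 [Balaban1987RG1] ((0.4)/(0.11) p.253: the block averaging and
its iteration; (0.2) p.252: plaquette variables).
-/

noncomputable section

namespace Summit.QuantumFields.YangMills.Theorems.CoarseStiffnessTailUnitSlice

open MeasureTheory
open Literature.MathematicalPhysics.QuantumFieldTheory
open Literature.MathematicalPhysics.QuantumFieldTheory.Balaban1983to89
open Literature.MathematicalPhysics.QuantumFieldTheory.Balaban1983to89.T3ContinuumYM3Torus
open Literature.MathematicalPhysics.QuantumFieldTheory.Balaban1983to89.T3UnitScaleTilt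
open Literature.MathematicalPhysics.QuantumFieldTheory.Balaban1983to89.T3UnitLawDensityEML
open Literature.MathematicalPhysics.QuantumFieldTheory.Balaban1983to89.T3LevelShift
open Literature.MathematicalPhysics.QuantumFieldTheory.Balaban1983to89.T3ThresholdRemoval

/-! ## §1 Transport identities: level sums of plaquette functions under the level identification -/

section Transport

variable (F : T3Family) {G : Type*} [GaugeGroup G]

/-- Level sums of a function of the plaquette variables correspond under the level identification `fieldShift` of two towers
(reindex by `plaqShift`, `plaqHol_fieldShift`). [cite: Balaban1987RG1, (0.2) p.252] -/
theorem sum_plaq_fieldShift {m K j m' K' j' : ℕ} (h : (F.PP m K).sitesPerDir j = (F.PP m' K').sitesPerDir j')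
    (W : GaugeField (F.PP m' K') j' G) (g : G → ℝ) :
    ∑ a : Plaq (F.PP m K) j, g (GaugeField.plaqHol (fieldShift h W) a) =
      ∑ a' : Plaq (F.PP m' K') j', g (GaugeField.plaqHol W a') := by
  simp_rw [plaqHol_fieldShift h W]
  exact Equiv.sum_comp (plaqShift h) (fun a' => g (GaugeField.plaqHol W a'))

/-- Level `j` of run `j + d` of `F` and level `j` (the top) of run `j` of `F.refine d` have the same number of plaquettes.
[cite: Balaban1985UV3, (1)-(3) p.256] -/
theorem card_plaq_eq_refine (d j : ℕ) :
    Fintype.card (Plaq (F.P (j + d)) j) = Fintype.card (Plaq ((F.refine d).P j) j) :=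
  Fintype.card_congr (plaqShift (F.sitesPerDir_eq (m := F.m) (K := j + d) (j := j) (m' := F.m + d) (K' := j) (j' := j) (by omega)))

/-- The unit lattice of run `K` (level `K` of `F.P K`) and of run `0` (level `0` of `F.P 0`) have the same number of plaquettes.
[cite: Balaban1985UV3, (1)-(3) p.256] -/
theorem card_plaq_top_eq_unit (K : ℕ) :
    Fintype.card (Plaq (F.P K) K) = Fintype.card (Plaq (F.P 0) 0) :=
  (Fintype.card_congr (plaqShift (F.sitesPerDir_unit K))).symm

/-- The window shifts with the coupling: `θ_{L,γ}(d) = θ_{L,γL^{-d}}(0)` (`θ(i) = g_i·p(g_i)`, `g_i² = γL^{-i}`; the `i = 0` instance of the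
tree's `LargeFieldMassRefinementTailOfHeightTail.θBal_mul_pow`, restated here to keep this file's imports inside the route).
[cite: Balaban1985UV3, (3) p.256 and (7) p.257] -/
theorem θBal_eq_θBal_refine_zero (L : ℕ) (γ b₀ p₀ : ℝ) (d : ℕ) :
    T3UnitScaleTilt.θBal L γ b₀ p₀ d = T3UnitScaleTilt.θBal L (γ * ((L : ℝ)⁻¹) ^ d) b₀ p₀ 0 := by
  unfold T3UnitScaleTilt.θBal
  rw [pow_zero, mul_one]

/-- **RUN `j + d` OF `F` AT HEIGHT `d` IS THE TOP OF RUN `j` OF `F.refine d`**: the Gibbs integral (run `j + d`, coupling `γ`) of any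
tilt `exp(c·Σ_a min(|Ū^{j}(∂a) − 1|², t²))` of the level-`j` averaged plaquette field equals the Gibbs integral (run `j` of the refined family
`F.refine d`, coupling `γL^{-d}`) of the same tilt of ITS level-`j` = unit-lattice averaged field — same finest lattice and Wilson weight
(`T3ThresholdRemoval.integral_gibbsMeasure_comp_fieldShift`, `T3Family.refine_β`), block averagings matched level by level
(`T3LevelShift.iter_fieldShift`), plaquettes reindexed (`plaqShift`). [cite: Balaban1985UV3, (1)-(3) p.256] -/
theorem integral_capTilt_eq_refine {γ : ℝ} (hγ : 0 ≤ γ) (c t : ℝ) (d j : ℕ) :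
    ∫ U, Real.exp (c * ∑ a : Plaq (F.P (j + d)) j, min (GaugeGroup.dist1 (GaugeField.plaqHol
        (Averaging.iter (fun i => BlockAveraging.blockAvg (P := F.P (j + d)) (j := i) T3UnitLawDensityEML.ℰp) j U) a) ^ 2) (t ^ 2))
        ∂(T3UnitScaleTilt.gibbsK F T3UnitLawDensityEML.ℰp γ (j + d)) =
      ∫ V, Real.exp (c * ∑ a' : Plaq ((F.refine d).P j) j, min (GaugeGroup.dist1 (GaugeField.plaqHol
        (Averaging.iter (fun i => BlockAveraging.blockAvg (P := (F.refine d).P j) (j := i) T3UnitLawDensityEML.ℰp) j V) a') ^ 2) (t ^ 2))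
        ∂(T3UnitScaleTilt.gibbsK (F.refine d) T3UnitLawDensityEML.ℰp (γ * ((F.L : ℝ)⁻¹) ^ d) j) := by
  have hβ : ((F.refine d).scheme ℰp (γ * ((F.L : ℝ)⁻¹) ^ d)).β j = (F.scheme ℰp γ).β (j + d) := F.refine_β ℰp γ d j
  have hβ0 : 0 ≤ (F.scheme ℰp γ).β (j + d) := F.scheme_β_nonneg ℰp hγ (j + d)
  have hmK : F.m + (j + d) = F.m + d + j := by omega
  rw [gibbsK_eq, gibbsK_eq, hβ]
  refine ((integral_gibbsMeasure_comp_fieldShift (G := Matrix.specialUnitaryGroup (Fin 2) ℂ)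
    (sitesPerDir_refine_zero F d j) hβ0 _).symm).trans ?_
  refine integral_congr_ae (Filter.Eventually.of_forall fun V => ?_)
  have key := iter_fieldShift ℰp hmK j V
  simp only
  erw [key]
  exact congrArg (fun x : ℝ => Real.exp (c * x))
    (sum_plaq_fieldShift F _ _ (fun u => min (GaugeGroup.dist1 u ^ 2) (t ^ 2)))

/-- **THE TOP SLICE IS AN INTEGRAL AGAINST THE UNIT LAW**: the Gibbs integral (run `K`) of a tilt of the `K`-fold averaged (unit-lattice)
plaquette field equals the integral of the same tilt of the plaquette field against Bałaban's unit law `unitLaw F ℰp γ K` (the push-forward of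
`gibbsK` under the unit transport `unitA = unitShift ∘ avg^K`; `T3ThresholdRemoval.integral_unitLaw`, plaquettes reindexed by `plaqShift`).
[cite: Balaban1985UV3, (1)-(3) p.256] -/
theorem integral_unitLaw_capTilt_eq (γ c t : ℝ) (K : ℕ) :
    ∫ V, Real.exp (c * ∑ p : Plaq (F.P 0) 0, min (GaugeGroup.dist1 (GaugeField.plaqHol V p) ^ 2) (t ^ 2))
        ∂(F.unitLaw T3UnitLawDensityEML.ℰp measurableE_ℰp γ K) =
      ∫ U, Real.exp (c * ∑ a : Plaq (F.P K) K, min (GaugeGroup.dist1 (GaugeField.plaqHol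
        (Averaging.iter (fun i => BlockAveraging.blockAvg (P := F.P K) (j := i) T3UnitLawDensityEML.ℰp) K U) a) ^ 2) (t ^ 2))
        ∂(T3UnitScaleTilt.gibbsK F T3UnitLawDensityEML.ℰp γ K) := by
  have hf : Measurable fun V : GaugeField (F.P 0) 0 (Matrix.specialUnitaryGroup (Fin 2) ℂ) =>
      Real.exp (c * ∑ p : Plaq (F.P 0) 0, min (GaugeGroup.dist1 (GaugeField.plaqHol V p) ^ 2) (t ^ 2)) :=
    (measurable_const.mul (Finset.measurable_sum _ fun p _ =>
      ((RegularGaugeGroup.measurable_dist1.comp (Missing.measurable_plaqHol p)).pow_const 2).min measurable_const)).exp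
  rw [integral_unitLaw measurableE_ℰp K hf, gibbsK_eq]
  refine integral_congr_ae (Filter.Eventually.of_forall fun U => ?_)
  exact congrArg (fun x : ℝ => Real.exp (c * x))
    (sum_plaq_fieldShift F (F.sitesPerDir_unit K) _ (fun u => min (GaugeGroup.dist1 u ^ 2) (t ^ 2)))

end Transport

/-! ## §2 The crux ⇔ its top slice `j = K` ⇔ the windowed sub-Gaussian stiffness of the unit law

All three statements are written out (no definition is posited).  `TopSlice` is the crux's body at `j = K` only (tilt
`c₀·γ⁻¹·Σ_{a ∈ Plaq_K} min(|Ū^{K}(∂a) − 1|², θBal(0)²)` of the `K`-fold averaged = unit-lattice plaquette field, bound `e^{C₀·#Plaq_K}`);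
`UnitLawSlice` is the same exponential moment written against Bałaban's unit law `unitLaw F ℰp γ K` on unit-lattice configurations
(volume factor `#Plaq (F.P 0) 0 = 3·(2L^m)³`, independent of `K`). -/

section Slices

/-- **crux ⇒ top slice** (specialise `j := K`: `(γL^{−0})⁻¹ = γ⁻¹`, `θBal(K − K) = θBal(0)`); constants kept. [cite: Balaban1985UV3, (1)-(3) p.256] -/
theorem topSlice_of_cappedCoarseStiffnessL
    (h : Summit.QuantumFields.YangMills.Theses.CoarseStiffnessTail.CappedCoarseStiffnessL) :
    ∀ (L : ℕ) (b₀ p₀ : ℝ), 0 < b₀ → 2 < p₀ → ∃ (c₀ C₀ γ₁ : ℝ), 0 < c₀ ∧ 0 < γ₁ ∧ γ₁ ≤ 1 ∧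
      ∀ (F : T3Family) (γ : ℝ), F.L = L → 0 < γ → γ ≤ γ₁ → ∀ (K : ℕ),
        ∫ U, Real.exp (c₀ * γ⁻¹ * ∑ a : Plaq (F.P K) K, min (GaugeGroup.dist1 (GaugeField.plaqHol
            (Averaging.iter (fun i => BlockAveraging.blockAvg (P := F.P K) (j := i) T3UnitLawDensityEML.ℰp) K U) a) ^ 2)
            (T3UnitScaleTilt.θBal F.L γ b₀ p₀ 0 ^ 2)) ∂(T3UnitScaleTilt.gibbsK F T3UnitLawDensityEML.ℰp γ K) ≤
          Real.exp (C₀ * (Fintype.card (Plaq (F.P K) K) : ℝ)) := by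
  intro L b₀ p₀ hb₀ hp₀
  obtain ⟨c₀, C₀, γ₁, hc₀, hγ₁, hγ₁1, hb⟩ := h L b₀ p₀ hb₀ hp₀
  refine ⟨c₀, C₀, γ₁, hc₀, hγ₁, hγ₁1, fun F γ hFL hγ hγγ₁ K => ?_⟩
  have key := hb F γ hFL hγ hγγ₁ K K le_rfl
  rw [Nat.sub_self, pow_zero, mul_one] at key
  exact key

/-- **top slice ⇒ crux** — THE REDUCTION: the crux at cut-off `K = j + d` and height `d` for `(F, γ)` is its top slice for the refined family
`F.refine d` (volume exponent `m + d`) at the smaller coupling `γL^{-d} ≤ γ ≤ γ₁` and cut-off `j` (`integral_capTilt_eq_refine`; the threshold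
shifts by `θ_{γL^{-d}}(0) = θ_γ(d)`, `θBal_eq_θBal_refine_zero`; `β_{K−j}(γ) = (γL^{-d})⁻¹`; plaquette counts agree, `card_plaq_eq_refine`).  So uniformity in
the height `j ≤ K` is AUTOMATIC from uniformity in the coupling `γ ≤ γ₁` and in the volume exponent `m`; constants kept.
[cite: Balaban1985UV3, (1)-(3) p.256 and (7) p.257] -/
theorem cappedCoarseStiffnessL_of_topSlice
    (h : ∀ (L : ℕ) (b₀ p₀ : ℝ), 0 < b₀ → 2 < p₀ → ∃ (c₀ C₀ γ₁ : ℝ), 0 < c₀ ∧ 0 < γ₁ ∧ γ₁ ≤ 1 ∧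
      ∀ (F : T3Family) (γ : ℝ), F.L = L → 0 < γ → γ ≤ γ₁ → ∀ (K : ℕ),
        ∫ U, Real.exp (c₀ * γ⁻¹ * ∑ a : Plaq (F.P K) K, min (GaugeGroup.dist1 (GaugeField.plaqHol
            (Averaging.iter (fun i => BlockAveraging.blockAvg (P := F.P K) (j := i) T3UnitLawDensityEML.ℰp) K U) a) ^ 2)
            (T3UnitScaleTilt.θBal F.L γ b₀ p₀ 0 ^ 2)) ∂(T3UnitScaleTilt.gibbsK F T3UnitLawDensityEML.ℰp γ K) ≤
          Real.exp (C₀ * (Fintype.card (Plaq (F.P K) K) : ℝ))) :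
    Summit.QuantumFields.YangMills.Theses.CoarseStiffnessTail.CappedCoarseStiffnessL := by
  intro L b₀ p₀ hb₀ hp₀
  obtain ⟨c₀, C₀, γ₁, hc₀, hγ₁, hγ₁1, hTop⟩ := h L b₀ p₀ hb₀ hp₀
  refine ⟨c₀, C₀, γ₁, hc₀, hγ₁, hγ₁1, fun F γ hFL hγ hγγ₁ K j hjK => ?_⟩
  obtain ⟨d, rfl⟩ := Nat.exists_eq_add_of_le hjK
  have hL0 : (0 : ℝ) < F.L := by exact_mod_cast (lt_trans zero_lt_one F.hL.2)
  have hL1 : (1 : ℝ) ≤ F.L := by exact_mod_cast F.hL.2.le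
  have hLinv : ((F.L : ℝ)⁻¹) ^ d ≤ 1 := pow_le_one₀ (inv_nonneg.mpr hL0.le) (inv_le_one_of_one_le₀ hL1)
  have hγ' : 0 < γ * ((F.L : ℝ)⁻¹) ^ d := mul_pos hγ (pow_pos (inv_pos.mpr hL0) _)
  have hγ'1 : γ * ((F.L : ℝ)⁻¹) ^ d ≤ γ₁ := (mul_le_of_le_one_right hγ.le hLinv).trans hγγ₁
  have key := hTop (F.refine d) (γ * ((F.L : ℝ)⁻¹) ^ d) hFL hγ' hγ'1 j
  rw [Nat.add_sub_cancel_left, integral_capTilt_eq_refine F hγ.le, card_plaq_eq_refine,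
    θBal_eq_θBal_refine_zero F.L γ b₀ p₀ d]
  exact key

/-- **crux ⇔ top slice**. [cite: Balaban1985UV3, (1)-(3) p.256] -/
theorem cappedCoarseStiffnessL_iff_topSlice :
    Summit.QuantumFields.YangMills.Theses.CoarseStiffnessTail.CappedCoarseStiffnessL ↔
    ∀ (L : ℕ) (b₀ p₀ : ℝ), 0 < b₀ → 2 < p₀ → ∃ (c₀ C₀ γ₁ : ℝ), 0 < c₀ ∧ 0 < γ₁ ∧ γ₁ ≤ 1 ∧
      ∀ (F : T3Family) (γ : ℝ), F.L = L → 0 < γ → γ ≤ γ₁ → ∀ (K : ℕ),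
        ∫ U, Real.exp (c₀ * γ⁻¹ * ∑ a : Plaq (F.P K) K, min (GaugeGroup.dist1 (GaugeField.plaqHol
            (Averaging.iter (fun i => BlockAveraging.blockAvg (P := F.P K) (j := i) T3UnitLawDensityEML.ℰp) K U) a) ^ 2)
            (T3UnitScaleTilt.θBal F.L γ b₀ p₀ 0 ^ 2)) ∂(T3UnitScaleTilt.gibbsK F T3UnitLawDensityEML.ℰp γ K) ≤
          Real.exp (C₀ * (Fintype.card (Plaq (F.P K) K) : ℝ)) :=
  ⟨topSlice_of_cappedCoarseStiffnessL, cappedCoarseStiffnessL_of_topSlice⟩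

/-- **top slice ⇔ unit-law slice** (`integral_unitLaw_capTilt_eq`, `card_plaq_top_eq_unit`; constants kept): the top slice is the statement
that Bałaban's UNIT LAW `unitLaw F ℰp γ K` — the law of the `K`-fold block-averaged field on the unit torus — has the windowed sub-Gaussian
stiffness `∫ exp(c₀γ⁻¹·Σ_p min(|V(∂p) − 1|², γ·p(√γ)²)) d(unitLaw) ≤ e^{C₀·#Plaq(unit torus)}`, uniformly in the cut-off `K`, the coupling
`0 < γ ≤ γ₁` and the volume exponent `m`. [cite: Balaban1985UV3, (1)-(3) p.256] -/
theorem topSlice_iff_unitLawSlice :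
    (∀ (L : ℕ) (b₀ p₀ : ℝ), 0 < b₀ → 2 < p₀ → ∃ (c₀ C₀ γ₁ : ℝ), 0 < c₀ ∧ 0 < γ₁ ∧ γ₁ ≤ 1 ∧
      ∀ (F : T3Family) (γ : ℝ), F.L = L → 0 < γ → γ ≤ γ₁ → ∀ (K : ℕ),
        ∫ U, Real.exp (c₀ * γ⁻¹ * ∑ a : Plaq (F.P K) K, min (GaugeGroup.dist1 (GaugeField.plaqHol
            (Averaging.iter (fun i => BlockAveraging.blockAvg (P := F.P K) (j := i) T3UnitLawDensityEML.ℰp) K U) a) ^ 2)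
            (T3UnitScaleTilt.θBal F.L γ b₀ p₀ 0 ^ 2)) ∂(T3UnitScaleTilt.gibbsK F T3UnitLawDensityEML.ℰp γ K) ≤
          Real.exp (C₀ * (Fintype.card (Plaq (F.P K) K) : ℝ))) ↔
    ∀ (L : ℕ) (b₀ p₀ : ℝ), 0 < b₀ → 2 < p₀ → ∃ (c₀ C₀ γ₁ : ℝ), 0 < c₀ ∧ 0 < γ₁ ∧ γ₁ ≤ 1 ∧
      ∀ (F : T3Family) (γ : ℝ), F.L = L → 0 < γ → γ ≤ γ₁ → ∀ (K : ℕ),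
        ∫ V, Real.exp (c₀ * γ⁻¹ * ∑ p : Plaq (F.P 0) 0, min (GaugeGroup.dist1 (GaugeField.plaqHol V p) ^ 2)
            (T3UnitScaleTilt.θBal F.L γ b₀ p₀ 0 ^ 2)) ∂(F.unitLaw T3UnitLawDensityEML.ℰp measurableE_ℰp γ K) ≤
          Real.exp (C₀ * (Fintype.card (Plaq (F.P 0) 0) : ℝ)) := by
  constructor
  · intro h L b₀ p₀ hb₀ hp₀
    obtain ⟨c₀, C₀, γ₁, hc₀, hγ₁, hγ₁1, hb⟩ := h L b₀ p₀ hb₀ hp₀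
    refine ⟨c₀, C₀, γ₁, hc₀, hγ₁, hγ₁1, fun F γ hFL hγ hγγ₁ K => ?_⟩
    rw [integral_unitLaw_capTilt_eq, ← card_plaq_top_eq_unit F K]
    exact hb F γ hFL hγ hγγ₁ K
  · intro h L b₀ p₀ hb₀ hp₀
    obtain ⟨c₀, C₀, γ₁, hc₀, hγ₁, hγ₁1, hb⟩ := h L b₀ p₀ hb₀ hp₀
    refine ⟨c₀, C₀, γ₁, hc₀, hγ₁, hγ₁1, fun F γ hFL hγ hγγ₁ K => ?_⟩
    rw [← integral_unitLaw_capTilt_eq, card_plaq_top_eq_unit F K]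
    exact hb F γ hFL hγ hγγ₁ K

/-- **THE CRUX IS A STATEMENT ABOUT THE UNIT LAWS** (`CappedCoarseStiffnessL ⇔ UnitLawSlice`): for every block size `L` and profile
`(b₀, p₀)` there are `c₀ > 0`, `C₀`, `γ₁ ∈ (0, 1]` such that for every family `F` with `F.L = L`, every `0 < γ ≤ γ₁` and every cut-off `K`,
`∫ exp(c₀·γ⁻¹·Σ_{p ∈ Plaq(T₁)} min(|V(∂p) − 1|², θBal L γ b₀ p₀ 0²)) d(unitLaw F ℰp γ K)(V) ≤ exp(C₀·#Plaq(T₁))` — i.e. the law of Bałaban's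
`K`-fold block-averaged unit-lattice field has free energy `O(1)` per unit plaquette under the capped quadratic tilt at ITS OWN coupling `γ`
(window `γ·p(√γ)²`), uniformly in `K` (ultraviolet stability), in `γ → 0` (this encodes the height: the crux at height `h = K − j` is the
unit slice at coupling `γL^{-h}`) and in the unit volume `(2L^m)³` (this encodes the level-`j` lattice: volume exponent `m + h`).
Constants are kept in both directions.  Conditional certificate: both sides are OPEN (XL). [cite: Balaban1985UV3, (1)-(3) p.256 and (5) p.256] -/
theorem cappedCoarseStiffnessL_iff_unitLawSlice :
    Summit.QuantumFields.YangMills.Theses.CoarseStiffnessTail.CappedCoarseStiffnessL ↔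
    ∀ (L : ℕ) (b₀ p₀ : ℝ), 0 < b₀ → 2 < p₀ → ∃ (c₀ C₀ γ₁ : ℝ), 0 < c₀ ∧ 0 < γ₁ ∧ γ₁ ≤ 1 ∧
      ∀ (F : T3Family) (γ : ℝ), F.L = L → 0 < γ → γ ≤ γ₁ → ∀ (K : ℕ),
        ∫ V, Real.exp (c₀ * γ⁻¹ * ∑ p : Plaq (F.P 0) 0, min (GaugeGroup.dist1 (GaugeField.plaqHol V p) ^ 2)
            (T3UnitScaleTilt.θBal F.L γ b₀ p₀ 0 ^ 2)) ∂(F.unitLaw T3UnitLawDensityEML.ℰp measurableE_ℰp γ K) ≤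
          Real.exp (C₀ * (Fintype.card (Plaq (F.P 0) 0) : ℝ)) :=
  cappedCoarseStiffnessL_iff_topSlice.trans topSlice_iff_unitLawSlice

end Slices

/-! ## §3 The bare unit-torus rung as a NECESSARY condition (cut-off `K = 0`: no averaging at all) -/

section Bare

/-- **crux ⇒ BARE WILSON CAPPED STIFFNESS ON THE UNIT TORUS** (the `K = 0` instance of the top slice; `Ū^{0} = U`): for every `L`, `(b₀, p₀)`
there are `c₀ > 0`, `C₀`, `γ₁` with `∫ exp(c₀γ⁻¹·Σ_p min(|U(∂p) − 1|², γ·p(√γ)²)) dGibbs_{β = γ⁻¹}(U) ≤ e^{C₀·#Plaq}` for the PURE WILSON law on the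
unit torus `(2L^m)³` (run `K = 0` of every family `F` with `F.L = L`), uniformly in `β = γ⁻¹ ≥ γ₁⁻¹` AND in the volume exponent `m` — the
line card's «j = 0 bare rung» in its cleanest form (by `integral_capTilt_eq_refine` the crux's whole `j = 0` sub-family IS this statement read over
all `(m, γ)`: height `K` at `(γ, m)` = bare at `(γL^{-K}, m + K)`).  A refutation of this bare statement refutes the crux. [cite: Balaban1985UV3, (1)-(3) p.256] -/
theorem bareSlice_of_cappedCoarseStiffnessL
    (h : Summit.QuantumFields.YangMills.Theses.CoarseStiffnessTail.CappedCoarseStiffnessL) :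
    ∀ (L : ℕ) (b₀ p₀ : ℝ), 0 < b₀ → 2 < p₀ → ∃ (c₀ C₀ γ₁ : ℝ), 0 < c₀ ∧ 0 < γ₁ ∧ γ₁ ≤ 1 ∧
      ∀ (F : T3Family) (γ : ℝ), F.L = L → 0 < γ → γ ≤ γ₁ →
        ∫ U, Real.exp (c₀ * γ⁻¹ * ∑ p : Plaq (F.P 0) 0, min (GaugeGroup.dist1 (GaugeField.plaqHol U p) ^ 2)
            (T3UnitScaleTilt.θBal F.L γ b₀ p₀ 0 ^ 2)) ∂(T3UnitScaleTilt.gibbsK F T3UnitLawDensityEML.ℰp γ 0) ≤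
          Real.exp (C₀ * (Fintype.card (Plaq (F.P 0) 0) : ℝ)) := by
  intro L b₀ p₀ hb₀ hp₀
  obtain ⟨c₀, C₀, γ₁, hc₀, hγ₁, hγ₁1, hb⟩ := topSlice_of_cappedCoarseStiffnessL h L b₀ p₀ hb₀ hp₀
  exact ⟨c₀, C₀, γ₁, hc₀, hγ₁, hγ₁1, fun F γ hFL hγ hγγ₁ => hb F γ hFL hγ hγγ₁ 0⟩

end Bare

end Summit.QuantumFields.YangMills.Theorems.CoarseStiffnessTailUnitSlice

end
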